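import Literature.Analysis.Convolution.OneSidedConvolutionPowers
import Mathlib.RingTheory.PowerSeries.Basic
import Mathlib.MeasureTheory.Constructions.BorelSpace.Order
import HarnessLib

/-!
# Lattice discretisation bounds for one-sided convolution powers

Topic `Literature/Analysis/Convolution` (companion of `OneSidedConvolution`, `OneSidedConvolutionPowers`).
Everything here is PROVED; standard axioms.

For a non-negative locally bounded `φ` on the half-line and a lattice span `h > 0` put
`p_j := ∫_{(jh, (j+1)h]} φ` (`cellMass φ h j`) and let `(p^{∗n})_m` (`dconvPow p n m`, the `m`-th coefficient of
`(Σ_j p_j X^j)^n`) be the `n`-fold discrete convolution power of the sequence of cell masses.  For every ANTITONE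
weight `Ψ ≥ 0` the weighted integrals of the `n`-fold one-sided convolution power `φ^{⋆n} = cpow φ n` are sandwiched
by the two lattice sums

  `Σ_m Ψ((m+n)h) (p^{∗n})_m ≤ ∫_{(0,X]} Ψ(x) φ^{⋆n}(x) dx ≤ Σ_m Ψ(mh) (p^{∗n})_m`      (∗)

(`sum_shift_mul_dconvPow_le_setIntegral`, `setIntegral_mul_cpow_le_sum`; the truncations of the two sums are
governed by `Ψ(X) = 0`, resp. `Ψ(Mh) = 0`).  This is the "rounding down / rounding up" (lower and upper
discretisation) of each of the `n` convolution factors to the lattice `hℕ`: writing `∫ Ψ φ^{⋆n}` as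
`∫ Ψ(t₁+⋯+t_n) ∏ φ(tᵢ) dt` and cutting `[0,∞)^n` into lattice boxes, on the box with corner `hJ` one has
`h|J| ≤ Σ tᵢ ≤ h(|J|+n)`, and `Σ_{|J| = m} ∏ p_{Jᵢ} = (p^{∗n})_m`.  In probabilistic language (`φ` a density,
`Ψ = 𝟙_{(−∞,s]}`) (∗) says `P(S⁻ₙ + nh ≤ s) ≤ P(Sₙ ≤ s) ≤ P(S⁻ₙ ≤ s)` for the sum `Sₙ` of `n` i.i.d. variables and
the sum `S⁻ₙ` of their roundings down to the lattice — the closure of the usual stochastic order under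
convolution [cite: ShakedShanthikumar2007, Thm 1.A.3(b)] applied to the coupling `h⌊X/h⌋ ≤ X ≤ h⌊X/h⌋ + h`,
i.e. the actuarial "method of rounding" [cite: KlugmanPanjerWillmot2004, §6.6.5.1] with the mass of each
cell dispersed to its lower / upper end point.
The proof here is the equivalent induction on `n` through the one-variable Fubini identity
`∫_{(0,X]} Ψ · (f ⋆ g) = ∫_{(0,X]} f(t) · (g ⋆ Ψ(X − ·))(X − t) dt` (`setIntegral_mul_oconv`).

Purpose (kernel certificates): the right-hand sides of (∗) are finite sums of products of cell masses, i.e.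
quantities a kernel computation can bound by exact (big-)integer arithmetic (Kronecker-packed polynomial powers,
cf. `Literature/Analysis/ValidatedNumerics/KroneckerDotProduct.lean`), while the middle terms are the
one-dimensional convolution integrals to which multiple integrals over the simplex of product test functions
reduce (`Literature.NumberTheory.Sieve.MaynardTao.setIntegral_simplex_sum_prod_eq_cpow`,
`….maynardFunctional_productTestFn`).  The algebra of `dconvPow` needed to justify repeated squaring with
truncation and outward rounding is recorded (`dconvPow_add`, `dconvPow_succ`, `dconv_mono`, `dconvPow_mono`,
non-negativity), and the two specialisations used for the Maynard–Polymath product test functions are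
`setIntegral_cpow_le_sum_dconvPow` (`∫_{(0,1]} φ^{⋆k} ≤ Σ_{mh ≤ 1} (p^{∗k})_m`) and
`sum_primitiveSq_mul_dconvPow_le` (the lower lattice sum for `∫_{(0,1]} (∫_{(0,1−w]} g)² (g²)^{⋆n}(w) dw`).
-/

noncomputable section

open MeasureTheory Set Finset
open scoped BigOperators

namespace Literature.Analysis.Convolution

/-! ### Discrete convolution and convolution powers of a sequence -/

/-- The discrete (Cauchy) convolution of two sequences: `(a ∗ b)_m = Σ_{i+j=m} a_i b_j` — formula (4) of
[cite: GathenGerhard2013ModernComputerAlgebra, §2.3 (4)] for the coefficients of a product of polynomials. -/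
def dconv (a b : ℕ → ℝ) (m : ℕ) : ℝ := ∑ ij ∈ antidiagonal m, a ij.1 * b ij.2

/-- The `n`-fold discrete convolution power of a sequence `p`: `(p^{∗n})_m` = the `m`-th coefficient of the
power series `(Σ_j p_j X^j)^n` (so `p^{∗0} = δ₀`, `p^{∗1} = p`), i.e. the iterated product (4).
[cite: GathenGerhard2013ModernComputerAlgebra, §2.3 (4)] -/
def dconvPow (p : ℕ → ℝ) (n m : ℕ) : ℝ := PowerSeries.coeff m ((PowerSeries.mk p) ^ n)

/-- `p^{∗0} = δ₀` (coefficients of the empty product). [cite: GathenGerhard2013ModernComputerAlgebra, §2.3 (4)] -/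
theorem dconvPow_zero (p : ℕ → ℝ) (m : ℕ) : dconvPow p 0 m = if m = 0 then 1 else 0 := by
  simp [dconvPow, PowerSeries.coeff_one]

/-- `p^{∗1} = p`. [cite: GathenGerhard2013ModernComputerAlgebra, §2.3 (4)] -/
@[simp] theorem dconvPow_one (p : ℕ → ℝ) (m : ℕ) : dconvPow p 1 m = p m := by
  simp [dconvPow]

/-- **Semigroup law** `p^{∗(n₁+n₂)} = p^{∗n₁} ∗ p^{∗n₂}` (coefficients of a product, (4)) — the identity behind
repeated squaring. [cite: GathenGerhard2013ModernComputerAlgebra, §2.3 (4)] -/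
theorem dconvPow_add (p : ℕ → ℝ) (n₁ n₂ m : ℕ) :
    dconvPow p (n₁ + n₂) m = dconv (dconvPow p n₁) (dconvPow p n₂) m := by
  simp [dconvPow, dconv, pow_add, PowerSeries.coeff_mul]

/-- `p^{∗(n+1)} = p ∗ p^{∗n}` (coefficients of a product, (4)). [cite: GathenGerhard2013ModernComputerAlgebra, §2.3 (4)] -/
theorem dconvPow_succ (p : ℕ → ℝ) (n m : ℕ) :
    dconvPow p (n + 1) m = dconv p (dconvPow p n) m := by
  rw [show n + 1 = 1 + n from add_comm n 1, dconvPow_add]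
  simp only [dconv, dconvPow_one]

/-- The product formula (4) is coefficientwise monotone in non-negative arguments. [cite: GathenGerhard2013ModernComputerAlgebra, §2.3 (4)] -/
theorem dconv_mono {a a' b b' : ℕ → ℝ} (ha0 : ∀ i, 0 ≤ a i) (hb0 : ∀ j, 0 ≤ b j)
    (ha : ∀ i, a i ≤ a' i) (hb : ∀ j, b j ≤ b' j) (m : ℕ) : dconv a b m ≤ dconv a' b' m :=
  Finset.sum_le_sum fun _ _ =>
    mul_le_mul (ha _) (hb _) (hb0 _) ((ha0 _).trans (ha _))

/-- `a, b ≥ 0 ⟹ a ∗ b ≥ 0` (formula (4)). [cite: GathenGerhard2013ModernComputerAlgebra, §2.3 (4)] -/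
theorem dconv_nonneg {a b : ℕ → ℝ} (ha0 : ∀ i, 0 ≤ a i) (hb0 : ∀ j, 0 ≤ b j) (m : ℕ) :
    0 ≤ dconv a b m :=
  Finset.sum_nonneg fun _ _ => mul_nonneg (ha0 _) (hb0 _)

/-- `p ≥ 0 ⟹ p^{∗n} ≥ 0` (iterating (4)). [cite: GathenGerhard2013ModernComputerAlgebra, §2.3 (4)] -/
theorem dconvPow_nonneg {p : ℕ → ℝ} (hp : ∀ j, 0 ≤ p j) : ∀ n m, 0 ≤ dconvPow p n m
  | 0, m => by rw [dconvPow_zero]; split_ifs <;> norm_num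
  | n + 1, m => by
      rw [dconvPow_succ]
      exact dconv_nonneg hp (dconvPow_nonneg hp n) m

/-- Convolution powers (iterated (4)) are coefficientwise monotone in a non-negative sequence (used to justify
outward rounding of the cell masses). [cite: GathenGerhard2013ModernComputerAlgebra, §2.3 (4)] -/
theorem dconvPow_mono {p q : ℕ → ℝ} (hp : ∀ j, 0 ≤ p j) (hpq : ∀ j, p j ≤ q j) :
    ∀ n m, dconvPow p n m ≤ dconvPow q n m
  | 0, m => by rw [dconvPow_zero, dconvPow_zero]
  | n + 1, m => by
      rw [dconvPow_succ, dconvPow_succ]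
      exact dconv_mono hp (dconvPow_nonneg hp n) hpq (dconvPow_mono hp hpq n) m

/-! ### Re-indexing a truncated double sum along antidiagonals -/

/-- `⋃_{m<M} {(i,j) : i+j = m} = {(i,j) ∈ [0,M)² : i + j < M}`. [folklore] -/
private theorem biUnion_range_antidiagonal (M : ℕ) :
    (range M).biUnion (fun m => antidiagonal m) =
      ((range M) ×ˢ (range M)).filter (fun ij : ℕ × ℕ => ij.1 + ij.2 < M) := by
  ext ⟨i, j⟩
  simp only [Finset.mem_biUnion, Finset.mem_range, Finset.mem_antidiagonal, Finset.mem_filter,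
    Finset.mem_product]
  constructor
  · rintro ⟨m, hm, hij⟩
    refine ⟨⟨?_, ?_⟩, ?_⟩ <;> omega
  · rintro ⟨-, h⟩
    exact ⟨i + j, h, rfl⟩

/-- `Σ_{m<M} Σ_{i+j=m} F(i,j) = Σ over {(i,j) ∈ [0,M)² : i+j<M}`. [folklore] -/
private theorem sum_range_sum_antidiagonal_eq_sum_filter (F : ℕ × ℕ → ℝ) (M : ℕ) :
    ∑ m ∈ range M, ∑ ij ∈ antidiagonal m, F ij =
      ∑ ij ∈ ((range M) ×ˢ (range M)).filter (fun ij : ℕ × ℕ => ij.1 + ij.2 < M), F ij := by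
  rw [← biUnion_range_antidiagonal, Finset.sum_biUnion]
  intro m _ m' _ hmm'
  simp only [Function.onFun]
  rw [Finset.disjoint_left]
  intro ij h1 h2
  rw [Finset.mem_antidiagonal] at h1 h2
  exact hmm' (h1.symm.trans h2)

/-- If `F(i,j) = 0` whenever `i + j ≥ M` then the square sum `Σ_{i<M} Σ_{j<M} F(i,j)` is the antidiagonal
sum `Σ_{m<M} Σ_{i+j=m} F(i,j)`. [folklore] -/
private theorem sum_range_sum_range_eq_sum_antidiagonal {F : ℕ × ℕ → ℝ} {M : ℕ}
    (hF : ∀ i j, M ≤ i + j → F (i, j) = 0) :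
    ∑ i ∈ range M, ∑ j ∈ range M, F (i, j) = ∑ m ∈ range M, ∑ ij ∈ antidiagonal m, F ij := by
  rw [sum_range_sum_antidiagonal_eq_sum_filter, ← Finset.sum_product (s := range M) (t := range M)
    (f := F), Finset.sum_filter_of_ne]
  rintro ⟨i, j⟩ _ hne
  by_contra h
  exact hne (hF i j (by omega))

/-- For `F ≥ 0` the antidiagonal sum `Σ_{m<M} Σ_{i+j=m} F(i,j)` is at most the square sum
`Σ_{i<M} Σ_{j<M} F(i,j)`. [folklore] -/
private theorem sum_antidiagonal_le_sum_range_sum_range {F : ℕ × ℕ → ℝ} (hF : ∀ ij, 0 ≤ F ij) (M : ℕ) :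
    ∑ m ∈ range M, ∑ ij ∈ antidiagonal m, F ij ≤ ∑ i ∈ range M, ∑ j ∈ range M, F (i, j) := by
  rw [sum_range_sum_antidiagonal_eq_sum_filter, ← Finset.sum_product (s := range M) (t := range M)
    (f := F)]
  exact Finset.sum_le_sum_of_subset_of_nonneg (Finset.filter_subset _ _) fun ij _ _ => hF ij

/-! ### Cell masses -/

/-- The mass of `φ` on the lattice cell `(jh, (j+1)h]`: `p_j = ∫_{(jh,(j+1)h]} φ` — the arithmetic
(lattice) distribution attached to a density by dispersing the mass of each cell to a lattice point.
[cite: KlugmanPanjerWillmot2004, §6.6.5.1 (method of rounding; here the cell (jh,(j+1)h])] -/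
def cellMass (φ : ℝ → ℝ) (h : ℝ) (j : ℕ) : ℝ := ∫ t in Ioc ((j : ℝ) * h) (((j : ℝ) + 1) * h), φ t

/-- Cell masses of a non-negative function are non-negative. [cite: KlugmanPanjerWillmot2004, §6.6.5.1 (method of rounding; here the cell (jh,(j+1)h])] -/
theorem cellMass_nonneg {φ : ℝ → ℝ} (hφ0 : ∀ t, 0 ≤ φ t) (h : ℝ) (j : ℕ) : 0 ≤ cellMass φ h j :=
  setIntegral_nonneg measurableSet_Ioc fun t _ => hφ0 t

/-- `p_j` as an interval integral (`h ≥ 0`). [cite: KlugmanPanjerWillmot2004, §6.6.5.1 (method of rounding; here the cell (jh,(j+1)h])] -/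
theorem cellMass_eq_intervalIntegral (φ : ℝ → ℝ) {h : ℝ} (hh : 0 ≤ h) (j : ℕ) :
    cellMass φ h j = ∫ t in ((j : ℝ) * h)..(((j : ℝ) + 1) * h), φ t := by
  rw [cellMass, intervalIntegral.integral_of_le]
  nlinarith

/-- Monotonicity of cell masses in the integrand (for outward rounding). [cite: KlugmanPanjerWillmot2004, §6.6.5.1 (method of rounding; here the cell (jh,(j+1)h])] -/
theorem cellMass_mono {φ ψ : ℝ → ℝ} (hφ : LocBdd φ) (hψ : LocBdd ψ) (hle : ∀ t, φ t ≤ ψ t) (h : ℝ)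
    (j : ℕ) : cellMass φ h j ≤ cellMass ψ h j :=
  setIntegral_mono_on (hφ.integrableOn_Ioc _ _) (hψ.integrableOn_Ioc _ _) measurableSet_Ioc
    fun t _ => hle t

/-! ### Antitone weights are locally bounded; shifted and reflected weights -/

section Weights

variable {Ψ f : ℝ → ℝ}

/-- A monotone (non-increasing) function is measurable and locally bounded. [folklore] -/
private theorem LocBdd.of_antitone (hΨ : Antitone Ψ) : LocBdd Ψ := by
  refine ⟨hΨ.measurable, fun A => ⟨max |Ψ (-A)| |Ψ A|, fun t ht => ?_⟩⟩
  rw [max_comm]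
  have h1 : Ψ A ≤ Ψ t := hΨ (abs_le.1 ht).2
  have h2 : Ψ t ≤ Ψ (-A) := hΨ (abs_le.1 ht).1
  exact abs_le_max_abs_abs h1 h2

/-- Reflections `t ↦ f(X − t)` of locally bounded functions are locally bounded. [folklore] -/
private theorem LocBdd.comp_const_sub (hf : LocBdd f) (X : ℝ) : LocBdd (fun t => f (X - t)) := by
  refine ⟨hf.measurable.comp (measurable_const.sub measurable_id), fun A => ?_⟩
  obtain ⟨C, hC⟩ := hf.bdd (|X| + A)
  refine ⟨C, fun t ht => hC _ ?_⟩
  exact (abs_sub _ _).trans (by linarith)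

/-- An antitone non-negative weight vanishing at `Y` vanishes on `[Y, ∞)`. [folklore] -/
private theorem eq_zero_of_antitone_of_le (hΨ : Antitone Ψ) (hΨ0 : ∀ x, 0 ≤ Ψ x) {Y x : ℝ} (hY : Ψ Y = 0)
    (hx : Y ≤ x) : Ψ x = 0 :=
  le_antisymm (hY ▸ hΨ hx) (hΨ0 x)

end Weights

/-! ### A weighted Fubini identity and truncation of vanishing tails -/

section Fubini

variable {Ψ f g : ℝ → ℝ}

/-- **Weighted integral of a convolution**: for locally bounded `Ψ, f, g`,
`∫_{(0,X]} Ψ(x) (f ⋆ g)(x) dx = ∫_{(0,X]} f(t) · (g ⋆ Ψ(X − ·))(X − t) dt`, i.e.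
`= ∫_{(0,X]} f(t) ∫_{(0,X−t]} g(u) Ψ(t + u) du dt` (Fubini on the triangle and the translation `u = x − t`).
[folklore] -/
private theorem setIntegral_mul_oconv (hΨ : LocBdd Ψ) (hf : LocBdd f) (hg : LocBdd g) (X : ℝ) :
    ∫ x in Ioc 0 X, Ψ x * oconv f g x =
      ∫ t in Ioc 0 X, f t * oconv g (fun v => Ψ (X - v)) (X - t) := by
  -- the kernel `K t x = f t g(x−t) Ψ x` and a uniform bound on `(0,X]²`
  obtain ⟨M, hM⟩ := exists_bound_kernel hf hg (hΨ.comp_const_sub X) X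
  have hK : Measurable (Function.uncurry fun t x => f t * g (x - t) * Ψ x) :=
    ((hf.measurable.comp measurable_fst).mul
      (hg.measurable.comp (measurable_snd.sub measurable_fst))).mul (hΨ.measurable.comp measurable_snd)
  have hM' : ∀ t ∈ Ioc 0 X, ∀ x ∈ Ioc 0 X, |f t * g (x - t) * Ψ x| ≤ M := by
    intro t ht x hx
    have := hM t ht x hx
    simpa only [sub_sub_cancel] using this
  have hL : ∫ x in Ioc 0 X, Ψ x * oconv f g x =
      ∫ x in Ioc 0 X, ∫ t in Ioc 0 x, f t * g (x - t) * Ψ x := by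
    refine setIntegral_congr_fun measurableSet_Ioc fun x _ => ?_
    rw [oconv, mul_comm, ← integral_mul_const]
  rw [hL, setIntegral_triangle_swap hK hM']
  refine setIntegral_congr_fun measurableSet_Ioc fun t ht => ?_
  have h1 : ∫ s in Ioc t X, f t * g (s - t) * Ψ s =
      f t * ∫ s in Ioc t X, (fun u => g u * Ψ (X - (X - t - u))) (s - t) := by
    rw [← integral_const_mul]
    refine setIntegral_congr_fun measurableSet_Ioc fun s _ => ?_
    simp only [mul_assoc]
    congr 2
    ring_nf
  rw [h1, setIntegral_Ioc_comp_sub (fun u => g u * Ψ (X - (X - t - u))) ht.2, oconv]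

/-- Truncation: if `F ≥ 0` on `(0,∞)` vanishes on `(Y, ∞)` and is integrable on `(0,Y]`, then
`∫_{(0,X]} F ≤ ∫_{(0,Y]} F` for every `X`. [folklore] -/
private theorem setIntegral_Ioc_le_of_eq_zero {F : ℝ → ℝ} {Y : ℝ} (hint : IntegrableOn F (Ioc 0 Y))
    (h0 : ∀ x, 0 < x → 0 ≤ F x) (hY : ∀ x, Y < x → F x = 0) (X : ℝ) :
    ∫ x in Ioc 0 X, F x ≤ ∫ x in Ioc 0 Y, F x := by
  have hF : F = (Iic Y).indicator F := by
    funext x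
    by_cases hx : x ≤ Y
    · rw [indicator_of_mem (show x ∈ Iic Y from hx)]
    · rw [indicator_of_notMem (show x ∉ Iic Y from hx), hY x (not_le.1 hx)]
  calc ∫ x in Ioc 0 X, F x = ∫ x in Ioc 0 X, (Iic Y).indicator F x := by rw [← hF]
    _ = ∫ x in Ioc 0 X ∩ Iic Y, F x := setIntegral_indicator measurableSet_Iic
    _ ≤ ∫ x in Ioc 0 Y, F x := by
        refine setIntegral_mono_set hint ?_ (Filter.Eventually.of_forall ?_)
        · rw [Filter.EventuallyLE, ae_restrict_iff' measurableSet_Ioc]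
          exact Filter.Eventually.of_forall fun x hx => h0 x hx.1
        · rintro x ⟨⟨hx0, -⟩, hxY⟩
          exact ⟨hx0, hxY⟩

end Fubini

/-! ### The case `n = 1`: one factor -/

section Base

variable {φ Ψ : ℝ → ℝ} {h : ℝ}

/-- Interval integrability of locally bounded functions. [folklore] -/
private theorem LocBdd.intervalIntegrable {F : ℝ → ℝ} (hF : LocBdd F) (a b : ℝ) :
    IntervalIntegrable F volume a b :=
  intervalIntegrable_iff.2 (hF.integrableOn_Ioc _ _)

/-- `∫_{(0, Mh]} F = Σ_{j<M} ∫_{jh}^{(j+1)h} F` for locally bounded `F` and `h ≥ 0`. [folklore] -/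
private theorem setIntegral_Ioc_eq_sum_intervalIntegral {F : ℝ → ℝ} (hF : LocBdd F) (hh : 0 ≤ h) (M : ℕ) :
    ∫ x in Ioc 0 ((M : ℝ) * h), F x =
      ∑ j ∈ range M, ∫ x in ((j : ℝ) * h)..(((j : ℝ) + 1) * h), F x := by
  have hsum := intervalIntegral.sum_integral_adjacent_intervals (a := fun k : ℕ => (k : ℝ) * h)
    (f := F) (μ := volume) (n := M) (fun k _ => hF.intervalIntegrable _ _)
  simp only [Nat.cast_zero, zero_mul, Nat.cast_succ] at hsum
  rw [intervalIntegral.integral_of_le (by positivity)] at hsum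
  exact hsum.symm

/-- Upper discretisation of one factor: for `φ ≥ 0` and antitone `Ψ ≥ 0` with `Ψ(Mh) = 0`,
`∫_{(0,X]} Ψ φ ≤ Σ_{j<M} Ψ(jh) p_j` (`E Ψ(X) ≤ E Ψ(X⁻)` for the rounded-down variable `X⁻ ≤ X`).
[cite: ShakedShanthikumar2007, (1.A.7) and Thm 1.A.3(b) (case m = 1)] -/
theorem setIntegral_mul_le_sum_cellMass (hφ : LocBdd φ) (hφ0 : ∀ t, 0 ≤ φ t) (hh : 0 < h)
    (hΨ : Antitone Ψ) (hΨ0 : ∀ x, 0 ≤ Ψ x) {M : ℕ} (hΨM : Ψ (M * h) = 0) (X : ℝ) :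
    ∫ x in Ioc 0 X, Ψ x * φ x ≤ ∑ j ∈ range M, Ψ (j * h) * cellMass φ h j := by
  have hΨl : LocBdd Ψ := LocBdd.of_antitone hΨ
  have hprod : LocBdd (fun x => Ψ x * φ x) := hΨl.mul hφ
  -- truncate the integral at `Y = M h`, where `Ψ` (hence the integrand) vanishes beyond
  have h1 : ∫ x in Ioc 0 X, Ψ x * φ x ≤ ∫ x in Ioc 0 ((M : ℝ) * h), Ψ x * φ x :=
    setIntegral_Ioc_le_of_eq_zero (hprod.integrableOn_Ioc _ _)
      (fun x _ => mul_nonneg (hΨ0 x) (hφ0 x))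
      (fun x hx => by rw [eq_zero_of_antitone_of_le hΨ hΨ0 hΨM hx.le, zero_mul]) X
  refine h1.trans ?_
  rw [setIntegral_Ioc_eq_sum_intervalIntegral hprod hh.le M]
  refine Finset.sum_le_sum fun j _ => ?_
  have hjh : (j : ℝ) * h ≤ ((j : ℝ) + 1) * h := by nlinarith
  calc ∫ x in ((j : ℝ) * h)..(((j : ℝ) + 1) * h), Ψ x * φ x
      ≤ ∫ x in ((j : ℝ) * h)..(((j : ℝ) + 1) * h), Ψ (j * h) * φ x := by
        refine intervalIntegral.integral_mono_on hjh (hprod.intervalIntegrable _ _)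
          ((hφ.const_mul _).intervalIntegrable _ _) fun x hx => ?_
        exact mul_le_mul_of_nonneg_right (hΨ hx.1) (hφ0 x)
    _ = Ψ (j * h) * cellMass φ h j := by
        rw [intervalIntegral.integral_const_mul, cellMass_eq_intervalIntegral φ hh.le]

/-- Lower discretisation of one factor: for `φ ≥ 0` and antitone `Ψ ≥ 0` with `Ψ(X) = 0`,
`Σ_{j<M} Ψ((j+1)h) p_j ≤ ∫_{(0,X]} Ψ φ` for every `M` (`E Ψ(X⁻ + h) ≤ E Ψ(X)` as `X ≤ X⁻ + h`).
[cite: ShakedShanthikumar2007, (1.A.7) and Thm 1.A.3(b) (case m = 1)] -/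
theorem sum_cellMass_le_setIntegral_mul (hφ : LocBdd φ) (hφ0 : ∀ t, 0 ≤ φ t) (hh : 0 < h)
    (hΨ : Antitone Ψ) (hΨ0 : ∀ x, 0 ≤ Ψ x) {X : ℝ} (hΨX : Ψ X = 0) (M : ℕ) :
    ∑ j ∈ range M, Ψ ((j + 1) * h) * cellMass φ h j ≤ ∫ x in Ioc 0 X, Ψ x * φ x := by
  have hΨl : LocBdd Ψ := LocBdd.of_antitone hΨ
  have hprod : LocBdd (fun x => Ψ x * φ x) := hΨl.mul hφ
  -- the integral over `(0, Mh]` is at most the integral over `(0, X]` (the integrand vanishes beyond `X`)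
  have h1 : ∫ x in Ioc 0 ((M : ℝ) * h), Ψ x * φ x ≤ ∫ x in Ioc 0 X, Ψ x * φ x :=
    setIntegral_Ioc_le_of_eq_zero (hprod.integrableOn_Ioc _ _)
      (fun x _ => mul_nonneg (hΨ0 x) (hφ0 x))
      (fun x hx => by rw [eq_zero_of_antitone_of_le hΨ hΨ0 hΨX hx.le, zero_mul]) _
  refine le_trans ?_ h1
  rw [setIntegral_Ioc_eq_sum_intervalIntegral hprod hh.le M]
  refine Finset.sum_le_sum fun j _ => ?_
  have hjh : (j : ℝ) * h ≤ ((j : ℝ) + 1) * h := by nlinarith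
  calc Ψ ((j + 1) * h) * cellMass φ h j
      = ∫ x in ((j : ℝ) * h)..(((j : ℝ) + 1) * h), Ψ ((j + 1) * h) * φ x := by
        rw [intervalIntegral.integral_const_mul, cellMass_eq_intervalIntegral φ hh.le]
    _ ≤ ∫ x in ((j : ℝ) * h)..(((j : ℝ) + 1) * h), Ψ x * φ x := by
        refine intervalIntegral.integral_mono_on hjh ((hφ.const_mul _).intervalIntegrable _ _)
          (hprod.intervalIntegrable _ _) fun x hx => ?_
        exact mul_le_mul_of_nonneg_right (hΨ hx.2) (hφ0 x)

end Base

/-! ### The sandwich for `n`-fold convolution powers -/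

section Main

variable {φ : ℝ → ℝ} {h : ℝ}

/-- The inner integral of the Fubini identity, rewritten with the shifted weight `u ↦ Ψ(u + t)`.
[folklore] -/
private theorem oconv_reflect_eq_setIntegral (g Ψ : ℝ → ℝ) (X t : ℝ) :
    oconv g (fun v => Ψ (X - v)) (X - t) = ∫ u in Ioc 0 (X - t), Ψ (u + t) * g u := by
  rw [oconv]
  refine setIntegral_congr_fun measurableSet_Ioc fun u _ => ?_
  have : X - (X - t - u) = u + t := by ring
  rw [this, mul_comm]

/-- **Upper lattice bound** (rounding every factor DOWN to the lattice `hℕ`): for `φ ≥ 0` locally bounded,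
`h > 0`, an antitone weight `Ψ ≥ 0` with `Ψ(Mh) = 0`, every `n ≥ 1` and every `X`,
`∫_{(0,X]} Ψ(x) φ^{⋆n}(x) dx ≤ Σ_{m<M} Ψ(mh) (p^{∗n})_m`, `p_j = ∫_{(jh,(j+1)h]} φ`.  Probabilistically:
`E Ψ(Sₙ) ≤ E Ψ(S⁻ₙ)` for the sum `S⁻ₙ ≤ Sₙ` of the rounded-down variables — the usual stochastic order is
closed under convolution. [cite: ShakedShanthikumar2007, Thm 1.A.3(b)] -/
theorem setIntegral_mul_cpow_le_sum (hφ : LocBdd φ) (hφ0 : ∀ t, 0 ≤ φ t) (hh : 0 < h) :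
    ∀ (n : ℕ) {Ψ : ℝ → ℝ}, Antitone Ψ → (∀ x, 0 ≤ Ψ x) → ∀ {M : ℕ}, Ψ (M * h) = 0 → ∀ X : ℝ,
      ∫ x in Ioc 0 X, Ψ x * cpow φ (n + 1) x ≤
        ∑ m ∈ range M, Ψ (m * h) * dconvPow (cellMass φ h) (n + 1) m
  | 0, Ψ, hΨ, hΨ0, M, hΨM, X => by
      simpa only [zero_add, cpow_one, dconvPow_one] using
        setIntegral_mul_le_sum_cellMass hφ hφ0 hh hΨ hΨ0 hΨM X
  | n + 1, Ψ, hΨ, hΨ0, M, hΨM, X => by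
      set p := cellMass φ h with hp
      set q := dconvPow p (n + 1) with hq
      have hp0 : ∀ j, 0 ≤ p j := cellMass_nonneg hφ0 h
      have hq0 : ∀ m, 0 ≤ q m := dconvPow_nonneg hp0 (n + 1)
      have hΨl : LocBdd Ψ := LocBdd.of_antitone hΨ
      have hg : LocBdd (cpow φ (n + 1)) := hφ.cpow (n + 1)
      -- shifted weights
      have hshA : ∀ c : ℝ, Antitone fun u => Ψ (u + c) := fun c a b hab =>
        hΨ (add_le_add hab (le_refl c))
      have hshA' : ∀ c : ℝ, Antitone fun u => Ψ (c + u) := fun c a b hab =>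
        hΨ (add_le_add (le_refl c) hab)
      have hvan : ∀ c : ℝ, 0 ≤ c → Ψ (M * h + c) = 0 := fun c hc =>
        eq_zero_of_antitone_of_le hΨ hΨ0 hΨM (by linarith)
      have hvan2 : ∀ c : ℝ, 0 ≤ c → Ψ (c + M * h) = 0 := fun c hc =>
        eq_zero_of_antitone_of_le hΨ hΨ0 hΨM (by linarith)
      -- Fubini
      rw [cpow_succ_succ, setIntegral_mul_oconv hΨl hφ hg X]
      -- the upper function is integrable
      have hUpper : LocBdd fun t => φ t * ∑ m ∈ range M, Ψ (m * h + t) * q m :=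
        hφ.mul (LocBdd.sum (range M) fun m _ => (LocBdd.of_antitone (hshA' _)).mul (LocBdd.const _))
      have hLower : LocBdd fun t => φ t * oconv (cpow φ (n + 1)) (fun v => Ψ (X - v)) (X - t) :=
        hφ.mul ((hg.oconv (hΨl.comp_const_sub X)).comp_const_sub X)
      calc ∫ t in Ioc 0 X, φ t * oconv (cpow φ (n + 1)) (fun v => Ψ (X - v)) (X - t)
          ≤ ∫ t in Ioc 0 X, φ t * ∑ m ∈ range M, Ψ (m * h + t) * q m := by
            refine setIntegral_mono_on (hLower.integrableOn_Ioc _ _) (hUpper.integrableOn_Ioc _ _)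
              measurableSet_Ioc fun t ht => ?_
            refine mul_le_mul_of_nonneg_left ?_ (hφ0 t)
            rw [oconv_reflect_eq_setIntegral]
            have hIH := setIntegral_mul_cpow_le_sum hφ hφ0 hh n (hshA t) (fun x => hΨ0 _)
              (M := M) (hvan t ht.1.le) (X - t)
            simpa only using hIH
        _ = ∑ m ∈ range M, q m * ∫ t in Ioc 0 X, Ψ (m * h + t) * φ t := by
            have : ∀ t, φ t * ∑ m ∈ range M, Ψ (m * h + t) * q m =
                ∑ m ∈ range M, q m * (Ψ (m * h + t) * φ t) := fun t => by
              rw [Finset.mul_sum]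
              exact Finset.sum_congr rfl fun m _ => by ring
            simp_rw [this]
            rw [integral_finsetSum _ fun m _ => ?_]
            · exact Finset.sum_congr rfl fun m _ => integral_const_mul _ _
            · exact (((LocBdd.of_antitone (hshA' _)).mul hφ).const_mul _).integrableOn_Ioc _ _
        _ ≤ ∑ m ∈ range M, q m * ∑ j ∈ range M, Ψ (m * h + j * h) * p j := by
            refine Finset.sum_le_sum fun m _ => mul_le_mul_of_nonneg_left ?_ (hq0 m)
            have := setIntegral_mul_le_sum_cellMass hφ hφ0 hh (hshA' (m * h)) (fun x => hΨ0 _)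
              (M := M) (hvan2 (m * h) (by positivity)) X
            simpa only using this
        _ = ∑ m' ∈ range M, Ψ (m' * h) * dconvPow p (n + 1 + 1) m' := by
            -- re-index the square sum along antidiagonals
            set F : ℕ × ℕ → ℝ := fun ij => Ψ (((ij.1 : ℝ) + ij.2) * h) * (p ij.1 * q ij.2) with hF
            have hF0 : ∀ i j, M ≤ i + j → F (i, j) = 0 := by
              intro i j hij
              have hle : (M : ℝ) * h ≤ ((i : ℝ) + j) * h :=
                mul_le_mul_of_nonneg_right (by exact_mod_cast hij) hh.le
              simp only [hF, eq_zero_of_antitone_of_le hΨ hΨ0 hΨM hle, zero_mul]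
            calc ∑ m ∈ range M, q m * ∑ j ∈ range M, Ψ (m * h + j * h) * p j
                = ∑ m ∈ range M, ∑ j ∈ range M, F (j, m) := by
                  refine Finset.sum_congr rfl fun m _ => ?_
                  rw [Finset.mul_sum]
                  refine Finset.sum_congr rfl fun j _ => ?_
                  simp only [hF]
                  have : (m : ℝ) * h + j * h = ((j : ℝ) + m) * h := by ring
                  rw [this]; ring
              _ = ∑ j ∈ range M, ∑ m ∈ range M, F (j, m) := Finset.sum_comm
              _ = ∑ m' ∈ range M, ∑ ij ∈ antidiagonal m', F ij :=
                  sum_range_sum_range_eq_sum_antidiagonal hF0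
              _ = ∑ m' ∈ range M, Ψ (m' * h) * dconvPow p (n + 1 + 1) m' := by
                  refine Finset.sum_congr rfl fun m' _ => ?_
                  rw [dconvPow_succ, dconv, Finset.mul_sum]
                  refine Finset.sum_congr rfl fun ij hij => ?_
                  rw [Finset.mem_antidiagonal] at hij
                  simp only [hF]
                  have : ((ij.1 : ℝ) + ij.2) = (m' : ℝ) := by exact_mod_cast hij
                  rw [this]

/-- **Lower lattice bound** (rounding every factor UP to the lattice `hℕ`): for `φ ≥ 0` locally bounded,
`h > 0`, an antitone weight `Ψ ≥ 0` with `Ψ(X) = 0`, every `n ≥ 1` and every `M`,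
`Σ_{m<M} Ψ((m+n)h) (p^{∗n})_m ≤ ∫_{(0,X]} Ψ(x) φ^{⋆n}(x) dx`.  Probabilistically: `E Ψ(S⁻ₙ + nh) ≤ E Ψ(Sₙ)`
since `Sₙ ≤ S⁻ₙ + nh`. [cite: ShakedShanthikumar2007, Thm 1.A.3(b)] -/
theorem sum_shift_mul_dconvPow_le_setIntegral (hφ : LocBdd φ) (hφ0 : ∀ t, 0 ≤ φ t) (hh : 0 < h) :
    ∀ (n : ℕ) {Ψ : ℝ → ℝ}, Antitone Ψ → (∀ x, 0 ≤ Ψ x) → ∀ {X : ℝ}, Ψ X = 0 → ∀ M : ℕ,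
      ∑ m ∈ range M, Ψ (((m + (n + 1) : ℕ) : ℝ) * h) * dconvPow (cellMass φ h) (n + 1) m ≤
        ∫ x in Ioc 0 X, Ψ x * cpow φ (n + 1) x
  | 0, Ψ, hΨ, hΨ0, X, hΨX, M => by
      have := sum_cellMass_le_setIntegral_mul hφ hφ0 hh hΨ hΨ0 hΨX M
      simpa only [cpow_one, dconvPow_one, Nat.cast_add, Nat.cast_one, zero_add] using this
  | n + 1, Ψ, hΨ, hΨ0, X, hΨX, M => by
      set p := cellMass φ h with hp
      set q := dconvPow p (n + 1) with hq
      have hp0 : ∀ j, 0 ≤ p j := cellMass_nonneg hφ0 h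
      have hq0 : ∀ m, 0 ≤ q m := dconvPow_nonneg hp0 (n + 1)
      have hΨl : LocBdd Ψ := LocBdd.of_antitone hΨ
      have hg : LocBdd (cpow φ (n + 1)) := hφ.cpow (n + 1)
      have hshA : ∀ c : ℝ, Antitone fun u => Ψ (u + c) := fun c a b hab =>
        hΨ (add_le_add hab (le_refl c))
      have hshA' : ∀ c : ℝ, Antitone fun u => Ψ (c + u) := fun c a b hab =>
        hΨ (add_le_add (le_refl c) hab)
      have hvan : ∀ c : ℝ, 0 ≤ c → Ψ (c + X) = 0 := fun c hc =>
        eq_zero_of_antitone_of_le hΨ hΨ0 hΨX (by linarith)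
      -- the shift `(n+1+1) h` split as `(n+1) h + h`-type bookkeeping is done on the real side
      set c : ℕ → ℝ := fun m => ((m + (n + 1) : ℕ) : ℝ) * h with hc
      rw [cpow_succ_succ, setIntegral_mul_oconv hΨl hφ hg X]
      have hUpper : LocBdd fun t => φ t * oconv (cpow φ (n + 1)) (fun v => Ψ (X - v)) (X - t) :=
        hφ.mul ((hg.oconv (hΨl.comp_const_sub X)).comp_const_sub X)
      have hLowerF : LocBdd fun t => φ t * ∑ m ∈ range M, Ψ (c m + t) * q m :=
        hφ.mul (LocBdd.sum (range M) fun m _ => (LocBdd.of_antitone (hshA' _)).mul (LocBdd.const _))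
      -- the antidiagonal re-indexing, as an inequality (extra terms are ≥ 0)
      set F : ℕ × ℕ → ℝ := fun ij => Ψ (c ij.2 + ((ij.1 : ℝ) + 1) * h) * (p ij.1 * q ij.2) with hF
      have hF0 : ∀ ij, 0 ≤ F ij := fun ij => mul_nonneg (hΨ0 _) (mul_nonneg (hp0 _) (hq0 _))
      calc ∑ m' ∈ range M, Ψ (((m' + (n + 1 + 1) : ℕ) : ℝ) * h) * dconvPow p (n + 1 + 1) m'
          = ∑ m' ∈ range M, ∑ ij ∈ antidiagonal m', F ij := by
            refine Finset.sum_congr rfl fun m' _ => ?_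
            rw [dconvPow_succ, dconv, Finset.mul_sum]
            refine Finset.sum_congr rfl fun ij hij => ?_
            rw [Finset.mem_antidiagonal] at hij
            simp only [hF, hc]
            have : (((m' + (n + 1 + 1) : ℕ) : ℝ)) * h =
                ((ij.2 + (n + 1) : ℕ) : ℝ) * h + ((ij.1 : ℝ) + 1) * h := by
              rw [← hij]; push_cast; ring
            rw [this]
        _ ≤ ∑ j ∈ range M, ∑ m ∈ range M, F (j, m) := sum_antidiagonal_le_sum_range_sum_range hF0 M
        _ = ∑ m ∈ range M, q m * ∑ j ∈ range M, Ψ (c m + (j + 1) * h) * p j := by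
            rw [Finset.sum_comm]
            refine Finset.sum_congr rfl fun m _ => ?_
            rw [Finset.mul_sum]
            refine Finset.sum_congr rfl fun j _ => ?_
            simp only [hF]
            ring
        _ ≤ ∑ m ∈ range M, q m * ∫ t in Ioc 0 X, Ψ (c m + t) * φ t := by
            refine Finset.sum_le_sum fun m _ => mul_le_mul_of_nonneg_left ?_ (hq0 m)
            have hcm : 0 ≤ c m := by simp only [hc]; positivity
            have := sum_cellMass_le_setIntegral_mul hφ hφ0 hh (hshA' (c m)) (fun x => hΨ0 _)
              (X := X) (hvan (c m) hcm) M
            simpa only using this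
        _ = ∫ t in Ioc 0 X, φ t * ∑ m ∈ range M, Ψ (c m + t) * q m := by
            have : ∀ t, φ t * ∑ m ∈ range M, Ψ (c m + t) * q m =
                ∑ m ∈ range M, q m * (Ψ (c m + t) * φ t) := fun t => by
              rw [Finset.mul_sum]
              exact Finset.sum_congr rfl fun m _ => by ring
            simp_rw [this]
            rw [integral_finsetSum _ fun m _ => ?_]
            · exact Finset.sum_congr rfl fun m _ => (integral_const_mul _ _).symm
            · exact (((LocBdd.of_antitone (hshA' _)).mul hφ).const_mul _).integrableOn_Ioc _ _
        _ ≤ ∫ t in Ioc 0 X, φ t * oconv (cpow φ (n + 1)) (fun v => Ψ (X - v)) (X - t) := by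
            refine setIntegral_mono_on (hLowerF.integrableOn_Ioc _ _) (hUpper.integrableOn_Ioc _ _)
              measurableSet_Ioc fun t ht => ?_
            refine mul_le_mul_of_nonneg_left ?_ (hφ0 t)
            rw [oconv_reflect_eq_setIntegral]
            have hIH := sum_shift_mul_dconvPow_le_setIntegral hφ hφ0 hh n (hshA t) (fun x => hΨ0 _)
              (X := X - t) (by simpa only [sub_add_cancel] using hΨX) M
            -- `Ψ_t(c m) = Ψ(c m + t)`
            simpa only [hc] using hIH

end Main

/-! ### The two specialisations used for product test functions -/

section Corollaries

variable {φ g : ℝ → ℝ} {h : ℝ}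

/-- **Denominator** (`P(S_k ≤ 1) ≤ P(S⁻_k ≤ 1)`): for `φ ≥ 0` locally bounded, `h > 0`, `M h > 1` and
`k ≥ 1`, `∫_{(0,1]} φ^{⋆k} ≤ Σ_{m<M} (p^{∗k})_m` with `p_j = ∫_{(jh,(j+1)h]} φ`.
[cite: ShakedShanthikumar2007, Thm 1.A.3(b)] -/
theorem setIntegral_cpow_le_sum_dconvPow (hφ : LocBdd φ) (hφ0 : ∀ t, 0 ≤ φ t) (hh : 0 < h)
    {M : ℕ} (hM : 1 < (M : ℝ) * h) {k : ℕ} (hk : 1 ≤ k) :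
    ∫ x in Ioc 0 1, cpow φ k x ≤ ∑ m ∈ range M, dconvPow (cellMass φ h) k m := by
  obtain ⟨n, rfl⟩ : ∃ n, k = n + 1 := ⟨k - 1, by omega⟩
  set Ψ : ℝ → ℝ := (Iic (1 : ℝ)).indicator fun _ => 1 with hΨdef
  have hΨ1 : ∀ x, x ≤ 1 → Ψ x = 1 := fun x hx => by
    simp only [hΨdef, indicator_of_mem (show x ∈ Iic (1:ℝ) from hx)]
  have hΨ0' : ∀ x, ¬ x ≤ 1 → Ψ x = 0 := fun x hx => by
    simp only [hΨdef, indicator_of_notMem (show x ∉ Iic (1:ℝ) from hx)]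
  have hΨ : Antitone Ψ := by
    intro a b hab
    by_cases hb : b ≤ 1
    · rw [hΨ1 b hb, hΨ1 a (hab.trans hb)]
    · rw [hΨ0' b hb]
      by_cases ha : a ≤ 1
      · rw [hΨ1 a ha]; norm_num
      · rw [hΨ0' a ha]
  have hΨ0 : ∀ x, 0 ≤ Ψ x := fun x => by
    by_cases hx : x ≤ 1
    · rw [hΨ1 x hx]; norm_num
    · rw [hΨ0' x hx]
  have hΨle : ∀ x, Ψ x ≤ 1 := fun x => by
    by_cases hx : x ≤ 1
    · rw [hΨ1 x hx]
    · rw [hΨ0' x hx]; norm_num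
  have hΨM : Ψ (M * h) = 0 := hΨ0' _ (not_le.2 hM)
  have hmain := setIntegral_mul_cpow_le_sum hφ hφ0 hh n hΨ hΨ0 hΨM 1
  have hL : ∫ x in Ioc 0 1, Ψ x * cpow φ (n + 1) x = ∫ x in Ioc 0 1, cpow φ (n + 1) x :=
    setIntegral_congr_fun measurableSet_Ioc fun x hx => by rw [hΨ1 x hx.2, one_mul]
  rw [hL] at hmain
  refine hmain.trans (Finset.sum_le_sum fun m _ => ?_)
  exact mul_le_of_le_one_left (dconvPow_nonneg (cellMass_nonneg hφ0 h) _ _) (hΨle _)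

/-- The square of a locally bounded function is locally bounded. [folklore] -/
private theorem LocBdd.sq (hg : LocBdd g) : LocBdd fun t => g t ^ 2 := by
  have : (fun t => g t ^ 2) = fun t => g t * g t := by funext t; ring
  rw [this]
  exact hg.mul hg

/-- **Numerator** (`E[G(1 − S⁻ₙ − nh)²] ≤ E[G(1 − Sₙ)²]` for the primitive `G(y) = ∫_{(0,y]} g`): for `g ≥ 0`
locally bounded, `h > 0`, every `n ≥ 1` and every `M`,
`Σ_{m<M} (∫_{(0, 1−(m+n)h]} g)² ((g²)^{∗n})_m ≤ ∫_{(0,1]} (∫₀^{1−w} g)² (g²)^{⋆n}(w) dw`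
(cell masses of `g²`; the right side is the integral of `Literature.NumberTheory.Sieve.MaynardTao.
maynardJ_productTestFn_eq_cpow`). [cite: ShakedShanthikumar2007, Thm 1.A.3(b)] -/
theorem sum_primitiveSq_mul_dconvPow_le (hg : LocBdd g) (hg0 : ∀ t, 0 ≤ g t) (hh : 0 < h)
    (n M : ℕ) :
    ∑ m ∈ range M, (∫ u in Ioc 0 (1 - ((m + (n + 1) : ℕ) : ℝ) * h), g u) ^ 2 *
        dconvPow (cellMass (fun t => g t ^ 2) h) (n + 1) m ≤
      ∫ w in Ioc 0 1, (∫ u in (0:ℝ)..(1 - w), g u) ^ 2 * cpow (fun t => g t ^ 2) (n + 1) w := by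
  set G : ℝ → ℝ := fun y => ∫ u in Ioc 0 y, g u with hGdef
  set Ψ : ℝ → ℝ := fun w => G (1 - w) ^ 2 with hΨdef
  have hG0 : ∀ y, 0 ≤ G y := fun y => setIntegral_nonneg measurableSet_Ioc fun u _ => hg0 u
  have hGmono : Monotone G := by
    intro a b hab
    exact setIntegral_mono_set (hg.integrableOn_Ioc _ _)
      (Filter.Eventually.of_forall fun u => hg0 u)
      (Filter.Eventually.of_forall (Ioc_subset_Ioc_right hab))
  have hΨ : Antitone Ψ := by
    intro a b hab
    simp only [hΨdef]
    exact pow_le_pow_left₀ (hG0 _) (hGmono (by linarith)) 2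
  have hΨ0 : ∀ x, 0 ≤ Ψ x := fun x => sq_nonneg _
  have hΨX : Ψ 1 = 0 := by simp [hΨdef, hGdef]
  have hmain := sum_shift_mul_dconvPow_le_setIntegral hg.sq (fun t => sq_nonneg _) hh n hΨ hΨ0
    hΨX M
  have hR : ∫ w in Ioc 0 1, Ψ w * cpow (fun t => g t ^ 2) (n + 1) w =
      ∫ w in Ioc 0 1, (∫ u in (0:ℝ)..(1 - w), g u) ^ 2 * cpow (fun t => g t ^ 2) (n + 1) w := by
    refine setIntegral_congr_fun measurableSet_Ioc fun w hw => ?_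
    simp only [hΨdef, hGdef]
    rw [intervalIntegral.integral_of_le (by linarith [hw.2])]
  rw [hR] at hmain
  simpa only [hΨdef, hGdef] using hmain

end Corollaries

end Literature.Analysis.Convolution
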